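import Literature.AlgebraicGeometry.Frobenioids.PerfFactorial
import HarnessLib

/-!
# Frobenioids I, Definition 2.4 (i): *weakly* perf-factorial monoids — condition (d) replaced by the
# two consequences (d_ord), (d_res) that §2–§4 use

Mochizuki, *The geometry of Frobenioids I*, Kyushu J. Math. **62** (2008), §2, Definition 2.4 (i),
kurims p. 47 [cite: MochizukiFrdI2008, Def. 2.4(i) p.47].  Condition (d) as printed (and as typed in
`PerfFactorial.lean`, `IsPerfFactorial.mem_range_of_supp_subset`): "If `a ∈ M^pf_factor` and `b ∈ M^pf`
satisfy `Supp(a) ⊆ Supp(b)`, then `a ∈ M^pf`. [Thus, in particular, if `a, b ∈ M^pf`, then an inequality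
`a ≤ b` holds in `M^pf` if and only if it holds in `M^pf_factor`.]"

WHY THIS FILE (erratum-neutral record).  For a monoid containing an infinite direct PRODUCT of monoprime
monoids (cell finding F-L2d2-1, seat abc-iut-L2-d2; lit register E-14; kernel witness
`PerfFactorialProductCounterexample.not_isPerfFactorial_multiplicative_pi_nat`, p413961:
`¬ IsPerfFactorial (Multiplicative (ℕ → ℕ))`), condition (d) fails — `M^pf` has bounded denominators
while `M^pf_factor` allows a different denominator in each factor.  Such monoids occur as divisor
monoids `Φ₀(Y^log)` of [EtTh] §3 at objects with infinitely many special-fibre components.  What the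
arguments of [FrdI] §2–§4 that invoke (d) actually use (e.g. the "primary factorizations" of the proof of
Prop. 4.1, pp. 76–77, `PerfFactorialSplitting.lean`) are two CONSEQUENCES of (d):

* (d_ord) — print's bracket: for `a, b ∈ M^pf`, "`a ≤ b` holds in `M^pf` if and only if it holds in
  `M^pf_factor`" (the non-trivial direction: divisibility inside `M^pf_factor` implies divisibility in
  `M^pf`);
* (d_res) — restriction: for `b ∈ M^pf` and any set `S` of primes, the element of `M^pf_factor` that
  agrees with `b` on `S` and vanishes off `S` lies in `M^pf`.

This file DEFINES `IsPerfFactorialWeak M` := (a), (b), (c) of Def. 2.4 (i) verbatim (the fields of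
`IsPerfFactorial`) + (d_ord) + (d_res); PROVES `IsPerfFactorial M → IsPerfFactorialWeak M`; and restates
for `IsPerfFactorialWeak` the two (d)-consumers of `PerfFactorialSplitting.lean` (seat abc-iut-L1-t14)
with the same names and statement shapes (`dvd_of_factorMap_mul_eq`, `exists_split`) and the
realification vocabulary of `PerfFactorial.lean` (`factorHom`, `realification`, `toRealification`,
`Rlf`), so that consumers re-target by changing the hypothesis only.  Nothing printed is re-typed as
if corrected: `IsPerfFactorial` (Def. 2.4 (i) as printed) is untouched; this is a NAMED WEAKENING for use
where (d) is unavailable.  Seat abc-iut-L1-t2 (author of record of `PerfFactorial.lean`; L1-lead R89 (2)).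
The positive instances (products / direct sums of monoprime monoids are weakly perf-factorial) are a
separate file.
-/

noncomputable section

namespace Literature.AlgebraicGeometry.Frobenioids

open Function

universe u

variable (M : Type u) [CommMonoid M]

/-- **Weakly perf-factorial** monoids: Def. 2.4 (i) (a) `M` divisorial, (b) every `M_𝔭` monoprime,
(c) the factorization map `M^pf → M^rlf_factor` is a well-defined injective homomorphism with image in
`M^pf_factor` — VERBATIM as in `IsPerfFactorial` — together with, in place of (d), its two consequences
(d_ord) "`a ≤ b` in `M^pf` iff in `M^pf_factor`" (print's bracket in (d)) and (d_res) "the restriction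
of `b ∈ M^pf` to any set of primes lies in `M^pf`".  `IsPerfFactorial M → IsPerfFactorialWeak M`
(`IsPerfFactorial.weak`); the converse fails for infinite products of monoprime monoids (F-L2d2-1).
[cite: MochizukiFrdI2008, Def. 2.4(i) p.47] -/
structure IsPerfFactorialWeak : Prop where
  /-- (a) `M` is divisorial -/
  isDivisorial : IsDivisorial M
  /-- (b) every `M_𝔭`, `𝔭 ∈ Prime(M)`, is monoprime -/
  isMonoprime : ∀ 𝔭 : Primes M, IsMonoprime ↥(𝔭.submonoid)
  /-- (c) well-defined: each `Bound_{𝔮 ∪ {0}}(a) ⊆ M^rlf_𝔮` is a bounded subset -/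
  bounded : ∀ (𝔮 : Primes (Perfection M)) (a : Perfection M), ∃ b, IsBoundedBy (boundAt M 𝔮 a) b
  /-- (c) homomorphism: unit -/
  factorMap_one : factorMap M 1 = 1
  /-- (c) homomorphism: products -/
  factorMap_mul : ∀ a b : Perfection M, factorMap M (a * b) = factorMap M a * factorMap M b
  /-- (c) injective -/
  factorMap_injective : Injective (factorMap M)
  /-- (c) the image lies in `M^pf_factor = ∏_𝔮 M^pf_𝔮 ⊆ M^rlf_factor` -/
  factorMap_mem_range : ∀ a : Perfection M, factorMap M a ∈ Set.range (pfFactorToRlfFactor M)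
  /-- (d_ord) if `b = a · x` in `M^pf_factor` (`x ∈ M^pf_factor`) then `a ≤ b` in `M^pf` ("an inequality
  `a ≤ b` holds in `M^pf` if and only if it holds in `M^pf_factor`") -/
  dvd_of_factorMap_mul_eq' : ∀ (a b : Perfection M) (x : PfFactor M),
    factorMap M a * pfFactorToRlfFactor M x = factorMap M b → a ∣ b
  /-- (d_res) for `b ∈ M^pf` and a set `S` of primes, the element of `M^pf_factor` equal to `b` on `S` and
  to `0` off `S` lies in `M^pf` -/
  exists_restrict : ∀ (b : Perfection M) (S : Set (Primes (Perfection M))), ∃ c : Perfection M,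
    ∀ 𝔮, (𝔮 ∈ S → factorMap M c 𝔮 = factorMap M b 𝔮) ∧ (𝔮 ∉ S → factorMap M c 𝔮 = 1)

variable {M}

/-! ### `perf-factorial ⇒ weakly perf-factorial` -/

/-- **Def. 2.4 (i) (d) implies (d_ord) and (d_res)**: a perf-factorial monoid is weakly perf-factorial.
((d_ord): `Supp(x) ⊆ Supp(b)` when `a · x = b`, so `x ∈ M^pf` by (d); (d_res): the restriction of `b`
has support inside `Supp(b)`.) [cite: MochizukiFrdI2008, Def. 2.4(i) p.47] -/
theorem IsPerfFactorial.weak (h : IsPerfFactorial M) : IsPerfFactorialWeak M where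
  isDivisorial := h.isDivisorial
  isMonoprime := h.isMonoprime
  bounded := h.bounded
  factorMap_one := h.factorMap_one
  factorMap_mul := h.factorMap_mul
  factorMap_injective := h.factorMap_injective
  factorMap_mem_range := h.factorMap_mem_range
  dvd_of_factorMap_mul_eq' a b x he := by
    have hsupp : supp (pfFactorToRlfFactor M x) ⊆ supp (factorMap M b) := by
      rw [← he, mul_comm]
      exact supp_subset_supp_mul _ _
    obtain ⟨c, hc⟩ := h.mem_range_of_supp_subset x b hsupp
    exact ⟨c, h.factorMap_injective (by rw [h.factorMap_mul, hc, he])⟩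
  exists_restrict b S := by
    classical
    obtain ⟨x, hx⟩ := h.factorMap_mem_range b
    -- the restriction of `x` to `S`, an element of `M^pf_factor` with support inside `Supp(b)`
    let y : PfFactor M := fun 𝔮 => if 𝔮 ∈ S then x 𝔮 else 1
    have hy : supp (pfFactorToRlfFactor M y) ⊆ supp (factorMap M b) := by
      intro 𝔮 h𝔮
      simp only [supp, Set.mem_setOf_eq, pfFactorToRlfFactor_apply] at h𝔮 ⊢
      by_cases hS : 𝔮 ∈ S
      · rw [← hx, pfFactorToRlfFactor_apply]
        simpa [y, hS] using h𝔮
      · simp [y, hS] at h𝔮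
    obtain ⟨c, hc⟩ := h.mem_range_of_supp_subset y b hy
    refine ⟨c, fun 𝔮 => ⟨fun hS => ?_, fun hS => ?_⟩⟩
    · rw [hc, ← hx, pfFactorToRlfFactor_apply, pfFactorToRlfFactor_apply]
      simp [y, hS]
    · rw [hc, pfFactorToRlfFactor_apply]
      simp [y, hS]

namespace IsPerfFactorialWeak

/-! ### The factorization homomorphism and the realification (as for `IsPerfFactorial`) -/

/-- The factorization homomorphism `M^pf → M^rlf_factor` (Def. 2.4 (i)(c)), as a monoid homomorphism.
[cite: MochizukiFrdI2008, Def. 2.4(i) p.47] -/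
def factorHom (h : IsPerfFactorialWeak M) : Perfection M →* RlfFactor M where
  toFun := factorMap M
  map_one' := h.factorMap_one
  map_mul' := h.factorMap_mul

/-- `factorHom` is `factorMap`. [cite: MochizukiFrdI2008, Def. 2.4(i) p.47] -/
@[simp] theorem factorHom_apply (h : IsPerfFactorialWeak M) (a : Perfection M) :
    h.factorHom a = factorMap M a := rfl

/-- The realification `M^rlf ⊆ M^rlf_factor`: the submonoid of the `a` with `Supp(a) ⊆ Supp(b)` for some
`b ∈ M^pf` (Def. 2.4 (i), p. 48) — same carrier as `IsPerfFactorial.realification`.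
[cite: MochizukiFrdI2008, Def. 2.4(i) p.48] -/
def realification (h : IsPerfFactorialWeak M) : Submonoid (RlfFactor M) where
  carrier := {a | ∃ b : Perfection M, supp a ⊆ supp (factorMap M b)}
  one_mem' := ⟨1, fun 𝔮 h𝔮 => (h𝔮 rfl).elim⟩
  mul_mem' := by
    rintro a a' ⟨b, hb⟩ ⟨b', hb'⟩
    refine ⟨b * b', fun 𝔮 h𝔮 => ?_⟩
    rw [h.factorMap_mul]
    rcases supp_mul_subset a a' h𝔮 with h₁ | h₁
    · exact supp_subset_supp_mul _ _ (hb h₁)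
    · rw [mul_comm]
      exact supp_subset_supp_mul _ _ (hb' h₁)

/-- `M^pf ⊆ M^rlf`. [cite: MochizukiFrdI2008, Def. 2.4(i) p.48] -/
theorem factorMap_mem_realification (h : IsPerfFactorialWeak M) (a : Perfection M) :
    factorMap M a ∈ h.realification :=
  ⟨a, subset_rfl⟩

/-- The natural map `M^pf → M^rlf`. [cite: MochizukiFrdI2008, Def. 2.4(i) p.48] -/
def toRealification (h : IsPerfFactorialWeak M) : Perfection M →* ↥h.realification :=
  h.factorHom.codRestrict _ h.factorMap_mem_realification

/-- The type `M^rlf`. [cite: MochizukiFrdI2008, Def. 2.4(i) p.48] -/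
abbrev Rlf (h : IsPerfFactorialWeak M) : Type u := ↥h.realification

/-! ### The two uses of (d) in [FrdI] §2–§4, from (d_ord) and (d_res) -/

/-- **(d_ord)**: divisibility in `M^pf` from divisibility inside `M^pf_factor` (shape of seat
abc-iut-L1-t14's `IsPerfFactorial.dvd_of_factorMap_mul_eq`). [cite: MochizukiFrdI2008, Def. 2.4(i) p.47] -/
theorem dvd_of_factorMap_mul_eq (h : IsPerfFactorialWeak M) {a b : Perfection M} {x : PfFactor M}
    (he : factorMap M a * pfFactorToRlfFactor M x = factorMap M b) : a ∣ b :=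
  h.dvd_of_factorMap_mul_eq' a b x he

/-- **(d_ord)**, `iff` form: "if `a, b ∈ M^pf`, then an inequality `a ≤ b` holds in `M^pf` if and only if
it holds in `M^pf_factor`" (print's bracket in Def. 2.4 (i)(d)). [cite: MochizukiFrdI2008, Def. 2.4(i) p.47] -/
theorem dvd_iff_exists_factorMap_mul_eq (h : IsPerfFactorialWeak M) (a b : Perfection M) :
    a ∣ b ↔ ∃ x : PfFactor M, factorMap M a * pfFactorToRlfFactor M x = factorMap M b := by
  refine ⟨?_, fun ⟨x, hx⟩ => h.dvd_of_factorMap_mul_eq hx⟩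
  rintro ⟨c, rfl⟩
  obtain ⟨x, hx⟩ := h.factorMap_mem_range c
  exact ⟨x, by rw [hx, h.factorMap_mul]⟩

/-- **(d_res) at one prime: the `𝔮`-component and the `𝔮`-free part** of `y ∈ M^pf` (shape of seat
abc-iut-L1-t14's `IsPerfFactorial.exists_split`; "the primary factorizations", Prop. 4.1, pp. 76–77).
[cite: MochizukiFrdI2008, Def. 2.4(i) p.47] -/
theorem exists_split (h : IsPerfFactorialWeak M) (y : Perfection M) (𝔮 : Primes (Perfection M)) :
    ∃ (y₁ y₂ : Perfection M) (x₁ : PfAt M 𝔮), y₁ * y₂ = y ∧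
      (haveI := Classical.decEq (Primes (Perfection M));
        factorMap M y₁ = pfFactorToRlfFactor M (Pi.mulSingle 𝔮 x₁)) ∧ factorMap M y₂ 𝔮 = 1 := by
  classical
  obtain ⟨x, hx⟩ := h.factorMap_mem_range y
  obtain ⟨y₁, hy₁⟩ := h.exists_restrict y {𝔮}
  obtain ⟨y₂, hy₂⟩ := h.exists_restrict y ({𝔮}ᶜ)
  refine ⟨y₁, y₂, x 𝔮, h.factorMap_injective ?_, ?_, ((hy₂ 𝔮).2 (by simp))⟩
  · rw [h.factorMap_mul]
    funext 𝔮'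
    rw [Pi.mul_apply]
    by_cases e : 𝔮' = 𝔮
    · subst e
      rw [(hy₁ 𝔮').1 rfl, (hy₂ 𝔮').2 (by simp), mul_one]
    · rw [(hy₁ 𝔮').2 (by simpa using e), (hy₂ 𝔮').1 (by simpa using e), one_mul]
  · funext 𝔮'
    rw [pfFactorToRlfFactor_apply]
    by_cases e : 𝔮' = 𝔮
    · subst e
      rw [(hy₁ 𝔮').1 rfl, Pi.mulSingle_eq_same, ← hx, pfFactorToRlfFactor_apply]
    · rw [(hy₁ 𝔮').2 (by simpa using e), Pi.mulSingle_eq_of_ne e, map_one]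

/-- **(d_res)**, general form with a computed witness: for `b ∈ M^pf` and a set `S` of primes there is
`c ∈ M^pf` whose factorization is the restriction of that of `b` to `S`.
[cite: MochizukiFrdI2008, Def. 2.4(i) p.47] -/
theorem exists_factorMap_eq_restrict (h : IsPerfFactorialWeak M) (b : Perfection M)
    (S : Set (Primes (Perfection M))) :
    ∃ c : Perfection M, haveI := Classical.decPred (· ∈ S);
      factorMap M c = fun 𝔮 => if 𝔮 ∈ S then factorMap M b 𝔮 else 1 := by
  classical
  obtain ⟨c, hc⟩ := h.exists_restrict b S
  refine ⟨c, funext fun 𝔮 => ?_⟩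
  by_cases hS : 𝔮 ∈ S
  · rw [if_pos hS, (hc 𝔮).1 hS]
  · rw [if_neg hS, (hc 𝔮).2 hS]

end IsPerfFactorialWeak

end Literature.AlgebraicGeometry.Frobenioids

end
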